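import Summits.AtomisticToContinuum.Crystallization.Theorems.FrustratedLawDichotomyStrainedPatchHomEntryFlipHcp
import Summits.AtomisticToContinuum.Crystallization.Theorems.FrustratedLawDichotomyStrainedPatchHomLeafTableSoundK
import Summits.AtomisticToContinuum.Crystallization.Theorems.FrustratedLawDichotomyStrainedPatchHomLeafTableDataCertK1b
import Summits.AtomisticToContinuum.Crystallization.Theorems.FrustratedLawDichotomyStrainedPatchHomLeafTableDataCertK2
import Summits.AtomisticToContinuum.Crystallization.Theorems.FrustratedLawDichotomyStrainedPatchHomLeafTableDataCertK3
import Summits.AtomisticToContinuum.Crystallization.Theorems.FrustratedLawDichotomyStrainedPatchHomLeafTableDataCertK4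

/-!
# The TIERED table verdict `tableLeafOKK` (checker v3, "K") and `(H) HomFloor` from two search Booleans with it

decomp-a2c hand-1 g22 (crux `AperiodicFrustratedLawGap`, stmt-AtomisticToContinuum-27623; critic rows 863/865 "checker v3").  hand-1 g21's Pilot D
located the leaf-size cap of the v2 table verdict `…HomEntryTable.tableLeafOK` in the rows' curvature RANGES (the label range check of `step3`, never
the inequality): entry half-width `2⁻¹²` everywhere.  A float model of `leafCheck` that reproduces Pilot D's printed slacks to four digits shows the
range a label needs is RELATIVE — `(r/q)max ≈ 22·h` uniformly over all zones at entry half-width `h` — so the fix is a family of tables with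
ρ-RELATIVE curvature ranges `[t(1−ρ), t(1+ρ) + step]` (`…HomLeafTableDataK1…4`, ρ = 0.03 / 0.06 / 0.12 / 0.24, each certified row-by-row by the v3
certification `Row.okK` of `…HomLeafTableRowK`: free ranges, curvature constant certified PIECEWISE with computed root brackets), tried in turn per leaf:

* §1 `tierTables` and its certificate (every tier passes `QT.allOKK tabE 7`);
* §2 `boxSum_ge_of_leafCheckK` — the fcc Gram-leaf floor from ONE `leafCheck` against ANY tier (`leafCheck_sound_fccK` of `…HomLeafTableSoundK` + the
  tree's list facts of `…HomLeafTableDataCert`); the checker `leafCheck` itself is UNCHANGED (kernel ≈ 0.4 s per tier tried);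
* §3 ★ `tableLeafOKK μ c w := cenOK ∧ tierTables.any (leafCheck · …)` with `tableLeafOKK_sound` in the `hver` shape of `…HomEntryGram.fccHalf_of_entryTree`;
* §4 the verdict chain of record with the tiers appended — `entryLeafOKBK := entryLeafOKB ∨ tableLeafOKK`, `entryLeafOKDBK` (sign ∨ dom ∨ ·),
  `entryLeafOKDBsK` (through the mirror), ★ `entryLeafOK6RBK := radOK ∘ symIdx ∨ entryLeafOKDBsK` — each with its soundness lemma (verbatim shapes of
  `…HomEntryDomBest` / `…HomEntrySymBox` / `…HomEntrySixHcpSharp`), `fccHalf_of_entrySearch6RBK`, and ★★★ `homFloor_of_entrySearches6RBK3RD` /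
  `homFloor_625_of_entrySearches6RBK3RD` / `homFloor_milli_of_entrySearches6RBK3RD` (fcc `entryLeafOK6RBK` × hcp `entryLeafOKH3RD`, the hcp side of the
  certificate of record v4 unchanged);
* §5 kernel smoke test: at the identity centre the tiered verdict ACCEPTS entry half-width `2⁻¹⁰` (`2^38`), where the v2 table verdict fails.

MODEL PREDICTION (to be confirmed by the pilot; HOME/decomp-a2c-hand-1/g22/model): largest accepted entry half-width 2⁻⁹ at the identity (v2: 2⁻¹²), 2⁻⁸ at
+24 % uniaxial / (−12,0,12) / (12,12,0) / (±6,±6,±6)…, 2⁻⁹ at shear 4–8 % and (−24,0,0); failures beyond are BY INEQUALITY (curvature term), i.e. margin-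
sensitive.  Computable definitions only; 0 sorry; standard axioms; no instances / notation / `#eval`.  `--supports stmt-AtomisticToContinuum-27623`.
-/

namespace Summit.AtomisticToContinuum.Crystallization.Theorems.FrustratedLawDichotomyStrainedPatchHomEntryTableK

open scoped BigOperators RealInnerProductSpace
open Literature.Analysis.ValidatedNumerics.Numerics
open Summit.AtomisticToContinuum.Crystallization.Theorems.ChargedEnergyGapNegative (E3)
open Summit.AtomisticToContinuum.Crystallization.Theorems.FrustratedLawDichotomySchurCut (effPot w₄₅ ω₄)
open Summit.AtomisticToContinuum.Crystallization.Theorems.FrustratedLawDichotomyAveragingRuleTightFree (TightNearCap BadNearCap)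
open Summit.AtomisticToContinuum.Crystallization.Theorems.FrustratedLawDichotomyExemptAbsorption (ExemptNear)
open Summit.AtomisticToContinuum.Crystallization.Theorems.FrustratedLawDichotomyStrainedPatchHomSplit
open Summit.AtomisticToContinuum.Crystallization.Theorems.FrustratedLawDichotomyStrainedPatchHomPrunedPolar (homFloor_of_prunedBoxSums_selfAdjoint)
open Summit.AtomisticToContinuum.Crystallization.Theorems.FrustratedLawDichotomyStrainedPatchHomEntryGram
open Summit.AtomisticToContinuum.Crystallization.Theorems.FrustratedLawDichotomyStrainedPatchHomEntryGramHcp (rootCH rootWH)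
open Summit.AtomisticToContinuum.Crystallization.Theorems.FrustratedLawDichotomyStrainedPatchHomEntryTable
  (tabGB cenOK tabGB_mem_box tableLeafOK sgnZ_natAbs muRec muRec_ok critC)
open Summit.AtomisticToContinuum.Crystallization.Theorems.FrustratedLawDichotomyStrainedPatchHomEntrySearch (searchOK exists_tree_of_searchOK)
open Summit.AtomisticToContinuum.Crystallization.Theorems.FrustratedLawDichotomyStrainedPatchHomEntrySym (domOut false_of_domOut)
open Summit.AtomisticToContinuum.Crystallization.Theorems.FrustratedLawDichotomyStrainedPatchHomEntrySign (signOut false_of_signOut fccHalf_of_entryTreeDom)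
open Summit.AtomisticToContinuum.Crystallization.Theorems.FrustratedLawDichotomyStrainedPatchHomEntrySix (symIdx hbox_sym muMilli muMilli_ok)
open Summit.AtomisticToContinuum.Crystallization.Theorems.FrustratedLawDichotomyStrainedPatchHomEntryRadial (radOK radOK_sound)
open Summit.AtomisticToContinuum.Crystallization.Theorems.FrustratedLawDichotomyStrainedPatchHomEntryBest (entryLeafOKB entryLeafOKB_sound)
open Summit.AtomisticToContinuum.Crystallization.Theorems.FrustratedLawDichotomyStrainedPatchHomEntrySymBox (symU hbox_symU)
open Summit.AtomisticToContinuum.Crystallization.Theorems.FrustratedLawDichotomyStrainedPatchHomEntryFlipHcp (entryLeafOKH3RD hcpHalf_of_entrySearchH3RD)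
open Summit.AtomisticToContinuum.Crystallization.Theorems.FrustratedLawDichotomyStrainedPatchHomLeafTableCheck
open Literature.Barriers.AtomisticToContinuum.FlatleyTheil2015 (fccVec)

/-! ## §1. The tier tables and their certificate -/

/-- ★ The four tier tables (relative curvature half-ranges ρ = 0.03, 0.06, 0.12, 0.24), tried in this order. -/
def tierTables : List QT := [qTableK1, qTableK2, qTableK3, qTableK4]

/-- Every tier passes the v3 row certification `QT.allOKK tabE 7`. [kernel computation] -/
theorem tierTables_allOKK : ∀ tab ∈ tierTables, QT.allOKK tabE 7 tab = true := by
  intro tab h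
  simp only [tierTables, List.mem_cons, List.not_mem_nil, or_false] at h
  rcases h with rfl | rfl | rfl | rfl
  · exact qTableK1_allOKK
  · exact qTableK2_allOKK
  · exact qTableK3_allOKK
  · exact qTableK4_allOKK

/-! ## §2. The fcc Gram-leaf floor from one `leafCheck` against any tier -/

/-- ★★ **THE fcc GRAM-LEAF CERTIFICATE against ANY TIER**: with a tier table `tab` and the tree's certified label data, one evaluation
`leafCheck tab nearLabels tabE tabA0 … tabA5 36 g sμ aμ = true` bounds the fcc box sum of every `G` with `‖G − 1‖ ≤ 1/4` whose frame Gram data lie in `g`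
(twin of `…HomLeafTableDataCert.boxSum_ge_of_leafCheck`, via `leafCheck_sound_fccK`). [folklore] -/
theorem boxSum_ge_of_leafCheckK {tab : QT} (htab : tab ∈ tierTables) {g : GB} {sμ : Bool} {aμ : ℕ}
    (h : leafCheck tab nearLabels tabE tabA0 tabA1 tabA2 tabA3 tabA4 tabA5 36 g sμ aμ = true) (G : E3 →L[ℝ] E3) (hG : ‖G - 1‖ ≤ 1 / 4)
    (hbox : ∀ i j : Fin 3, |⟪G (fccVec i), G (fccVec j)⟫ - ((g.cz i j : ℤ) : ℝ) / SC| ≤ ((g.wz i j : ℤ) : ℝ) / SC) :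
    ((sgnZ sμ aμ : ℤ) : ℝ) / SC ≤
      ∑ b ∈ (Fintype.piFinset fun _ : Fin 3 => Finset.Icc (-7 : ℤ) 7).filter (fun b => b ≠ 0), effPot w₄₅ ω₄ (3 / 400) ‖latPt G fccVec b‖ :=
  leafCheck_sound_fccK (P := 7) (Or.inr (tierTables_allOKK tab htab)) (ok_of_allNLok nearLabels_ok) (box_of_allInBox nearLabels_inBox)
    (canon_hyp_of_allCanon nearLabels_canon) (nodup_sorted_of_chainLt nearLabels_ok nearLabels_chain).1 (classSums_of_sumM nearLabels_sumM)
    (cover_of_coverCheck nearLabels_cover) (nodup_sorted_of_chainLt nearLabels_ok nearLabels_chain).2 le_rfl h G hG hbox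

/-! ## §3. The tiered table verdict -/

/-- ★ **THE TIERED TABLE VERDICT on an entry box**: guard ∧ the v2 leaf checker against the tier tables in turn (stop norm `36`, target `μ` in
sign–magnitude form); `List.any` short-circuits at the first accepting tier. -/
def tableLeafOKK (μ : ℤ) (c w : Fin 3 × Fin 3 → ℤ) : Bool :=
  cenOK c w && tierTables.any fun tab => leafCheck tab nearLabels tabE tabA0 tabA1 tabA2 tabA3 tabA4 tabA5 36 (tabGB c w) (decide (μ < 0)) μ.natAbs

/-- ★★ **SOUNDNESS OF THE TIERED TABLE VERDICT** (the `hver` shape of `…HomEntryGram.fccHalf_of_entryTree`, as `tableLeafOK_sound`): for every `U` with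
`‖U − 1‖ ≤ 1/4` whose entries lie in the box, the prune disjunct holds or `μ/SC ≤ Σ_{b ∈ [−7,7]³∖0} W₄₅ ‖latPt U fccVec b‖` (always the latter). [folklore] -/
theorem tableLeafOKK_sound {μ : ℤ} {c w : Fin 3 × Fin 3 → ℤ} (h : tableLeafOKK μ c w = true) (U : E3 →L[ℝ] E3)
    (_hsa : ∀ v v' : E3, ⟪U v, v'⟫ = ⟪v, U v'⟫) (hU : ‖U - 1‖ ≤ 1 / 4)
    (hbox : ∀ ab : Fin 3 × Fin 3, |(U (EuclideanSpace.single ab.2 (1 : ℝ))) ab.1 - (c ab : ℝ) / SC| ≤ (w ab : ℝ) / SC) :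
    (∀ (M : ℕ) (z : Fin M → E3) (c : Fin M), Function.Injective z →
        Set.range z = {x : E3 | dist x (z c) ≤ 133 / 10 ∧ ∃ a : Fin 3 → ℤ, x = z c + latPt U fccVec a} →
        TightNearCap (9 / 5) (3 / 2) z c ∨ ExemptNear (9 / 5) ExRec z c ∨ BadNearCap (9 / 5) (3 / 2) z c) ∨
      (μ : ℝ) / SC ≤ ∑ b ∈ (Fintype.piFinset fun _ : Fin 3 => Finset.Icc (-7 : ℤ) 7).filter (fun b => b ≠ 0),
        effPot w₄₅ ω₄ (3 / 400) ‖latPt U fccVec b‖ := by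
  simp only [tableLeafOKK, Bool.and_eq_true, List.any_eq_true] at h
  obtain ⟨hcen, tab, htab, hleaf⟩ := h
  refine Or.inr ?_
  have key := boxSum_ge_of_leafCheckK htab hleaf U hU (fun i j => tabGB_mem_box U hcen hbox i j)
  rwa [sgnZ_natAbs] at key

/-! ## §4. The verdict chain of record with the tiers appended -/

/-- ★ **fcc ENTRY-LEAF VERDICT, record ∨ tiers**: `entryLeafOKB μ` (Cartesian sharp fit ∨ sharp fit ∨ fit ∨ symmetry ∨ column ∨ v2 table) ∨ `tableLeafOKK μ`. -/
def entryLeafOKBK (μ : ℤ) (c w : Fin 3 × Fin 3 → ℤ) : Bool := entryLeafOKB μ c w || tableLeafOKK μ c w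

/-- ★ Soundness of `entryLeafOKBK` (shape of `…HomEntryGram.fccHalf_of_entryTree`). [folklore] -/
theorem entryLeafOKBK_sound {μ : ℤ} {c w : Fin 3 × Fin 3 → ℤ} (h : entryLeafOKBK μ c w = true) (U : E3 →L[ℝ] E3)
    (hsa : ∀ v v' : E3, ⟪U v, v'⟫ = ⟪v, U v'⟫) (hU : ‖U - 1‖ ≤ 1 / 4)
    (hbox : ∀ ab : Fin 3 × Fin 3, |(U (EuclideanSpace.single ab.2 (1 : ℝ))) ab.1 - (c ab : ℝ) / SC| ≤ (w ab : ℝ) / SC) :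
    (∀ (M : ℕ) (z : Fin M → E3) (c : Fin M), Function.Injective z →
        Set.range z = {x : E3 | dist x (z c) ≤ 133 / 10 ∧ ∃ a : Fin 3 → ℤ, x = z c + latPt U fccVec a} →
        TightNearCap (9 / 5) (3 / 2) z c ∨ ExemptNear (9 / 5) ExRec z c ∨ BadNearCap (9 / 5) (3 / 2) z c) ∨
      (μ : ℝ) / SC ≤ ∑ b ∈ (Fintype.piFinset fun _ : Fin 3 => Finset.Icc (-7 : ℤ) 7).filter (fun b => b ≠ 0),
        effPot w₄₅ ω₄ (3 / 400) ‖latPt U fccVec b‖ := by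
  simp only [entryLeafOKBK, Bool.or_eq_true] at h
  rcases h with h | h
  · exact entryLeafOKB_sound h U hsa hU hbox
  · exact tableLeafOKK_sound h U hsa hU hbox

/-- ★ **… OVER THE FUNDAMENTAL DOMAIN**: sign prune ∨ sorted-diagonal prune ∨ `entryLeafOKBK μ`. -/
def entryLeafOKDBK (μ : ℤ) (c w : Fin 3 × Fin 3 → ℤ) : Bool := signOut c w || domOut c w || entryLeafOKBK μ c w

/-- ★ Soundness of `entryLeafOKDBK` RELATIVE to the fundamental domain (`u₁₁ ≤ u₀₀`, `u₂₂ ≤ u₁₁`, `0 ≤ u₀₁`, `0 ≤ u₀₂`): the `hver` shape of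
`…HomEntrySign.fccHalf_of_entryTreeDom`. [folklore] -/
theorem entryLeafOKDBK_sound {μ : ℤ} {c w : Fin 3 × Fin 3 → ℤ} (h : entryLeafOKDBK μ c w = true) (U : E3 →L[ℝ] E3)
    (hsa : ∀ v v' : E3, ⟪U v, v'⟫ = ⟪v, U v'⟫) (hU : ‖U - 1‖ ≤ 1 / 4)
    (hbox : ∀ ab : Fin 3 × Fin 3, |(U (EuclideanSpace.single ab.2 (1 : ℝ))) ab.1 - (c ab : ℝ) / SC| ≤ (w ab : ℝ) / SC)
    (h1 : (U (EuclideanSpace.single 1 (1 : ℝ))) 1 ≤ (U (EuclideanSpace.single 0 (1 : ℝ))) 0)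
    (h2 : (U (EuclideanSpace.single 2 (1 : ℝ))) 2 ≤ (U (EuclideanSpace.single 1 (1 : ℝ))) 1)
    (h01 : 0 ≤ (U (EuclideanSpace.single 1 (1 : ℝ))) 0) (h02 : 0 ≤ (U (EuclideanSpace.single 2 (1 : ℝ))) 0) :
    (∀ (M : ℕ) (z : Fin M → E3) (c : Fin M), Function.Injective z →
        Set.range z = {x : E3 | dist x (z c) ≤ 133 / 10 ∧ ∃ a : Fin 3 → ℤ, x = z c + latPt U fccVec a} →
        TightNearCap (9 / 5) (3 / 2) z c ∨ ExemptNear (9 / 5) ExRec z c ∨ BadNearCap (9 / 5) (3 / 2) z c) ∨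
      (μ : ℝ) / SC ≤ ∑ b ∈ (Fintype.piFinset fun _ : Fin 3 => Finset.Icc (-7 : ℤ) 7).filter (fun b => b ≠ 0),
        effPot w₄₅ ω₄ (3 / 400) ‖latPt U fccVec b‖ := by
  simp only [entryLeafOKDBK, Bool.or_eq_true] at h
  rcases h with (h | h) | h
  · exact (false_of_signOut h (u := fun ab : Fin 3 × Fin 3 => (U (EuclideanSpace.single ab.2 (1 : ℝ))) ab.1) hbox h01 h02).elim
  · exact (false_of_domOut h (u := fun ab : Fin 3 × Fin 3 => (U (EuclideanSpace.single ab.2 (1 : ℝ))) ab.1) hbox h1 h2).elim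
  · exact entryLeafOKBK_sound h U hsa hU hbox

/-- ★ **… THROUGH THE SYMMETRISED BOX** (fundamental domain × record ∨ tiers). -/
def entryLeafOKDBsK (μ : ℤ) (c w : Fin 3 × Fin 3 → ℤ) : Bool := entryLeafOKDBK μ (symU c) (symU w)

/-- ★ Soundness of `entryLeafOKDBsK` RELATIVE to the fundamental domain. [folklore] -/
theorem entryLeafOKDBsK_sound {μ : ℤ} {c w : Fin 3 × Fin 3 → ℤ} (h : entryLeafOKDBsK μ c w = true) (U : E3 →L[ℝ] E3)
    (hsa : ∀ v v' : E3, ⟪U v, v'⟫ = ⟪v, U v'⟫) (hU : ‖U - 1‖ ≤ 1 / 4)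
    (hbox : ∀ ab : Fin 3 × Fin 3, |(U (EuclideanSpace.single ab.2 (1 : ℝ))) ab.1 - (c ab : ℝ) / SC| ≤ (w ab : ℝ) / SC)
    (h1 : (U (EuclideanSpace.single 1 (1 : ℝ))) 1 ≤ (U (EuclideanSpace.single 0 (1 : ℝ))) 0)
    (h2 : (U (EuclideanSpace.single 2 (1 : ℝ))) 2 ≤ (U (EuclideanSpace.single 1 (1 : ℝ))) 1)
    (h01 : 0 ≤ (U (EuclideanSpace.single 1 (1 : ℝ))) 0) (h02 : 0 ≤ (U (EuclideanSpace.single 2 (1 : ℝ))) 0) :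
    (∀ (M : ℕ) (z : Fin M → E3) (c : Fin M), Function.Injective z →
        Set.range z = {x : E3 | dist x (z c) ≤ 133 / 10 ∧ ∃ a : Fin 3 → ℤ, x = z c + latPt U fccVec a} →
        TightNearCap (9 / 5) (3 / 2) z c ∨ ExemptNear (9 / 5) ExRec z c ∨ BadNearCap (9 / 5) (3 / 2) z c) ∨
      (μ : ℝ) / SC ≤ ∑ b ∈ (Fintype.piFinset fun _ : Fin 3 => Finset.Icc (-7 : ℤ) 7).filter (fun b => b ≠ 0),
        effPot w₄₅ ω₄ (3 / 400) ‖latPt U fccVec b‖ :=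
  entryLeafOKDBK_sound h U hsa hU (hbox_symU hsa hbox) h1 h2 h01 h02

/-- ★ **SIX-COORDINATE fcc VERDICT WITH EVERY PRUNE IN THE TREE AND THE TIERS**: radial-bad prune (through the mirror) ∨ `entryLeafOKDBsK μ`. -/
def entryLeafOK6RBK (μ : ℤ) (c w : Fin 3 × Fin 3 → ℤ) : Bool := radOK (c ∘ symIdx) (w ∘ symIdx) || entryLeafOKDBsK μ c w

/-- ★ Soundness of `entryLeafOK6RBK` in the domain-relativised `hver` shape of `…HomEntrySign.fccHalf_of_entryTreeDom`. [folklore] -/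
theorem entryLeafOK6RBK_sound {μ : ℤ} {c w : Fin 3 × Fin 3 → ℤ} (h : entryLeafOK6RBK μ c w = true) (U : E3 →L[ℝ] E3)
    (hsa : ∀ v v' : E3, ⟪U v, v'⟫ = ⟪v, U v'⟫) (hU : ‖U - 1‖ ≤ 1 / 4)
    (hbox : ∀ ab : Fin 3 × Fin 3, |(U (EuclideanSpace.single ab.2 (1 : ℝ))) ab.1 - (c ab : ℝ) / SC| ≤ (w ab : ℝ) / SC)
    (h1 : (U (EuclideanSpace.single 1 (1 : ℝ))) 1 ≤ (U (EuclideanSpace.single 0 (1 : ℝ))) 0)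
    (h2 : (U (EuclideanSpace.single 2 (1 : ℝ))) 2 ≤ (U (EuclideanSpace.single 1 (1 : ℝ))) 1)
    (h01 : 0 ≤ (U (EuclideanSpace.single 1 (1 : ℝ))) 0) (h02 : 0 ≤ (U (EuclideanSpace.single 2 (1 : ℝ))) 0) :
    (∀ (M : ℕ) (z : Fin M → E3) (c : Fin M), Function.Injective z →
        Set.range z = {x : E3 | dist x (z c) ≤ 133 / 10 ∧ ∃ a : Fin 3 → ℤ, x = z c + latPt U fccVec a} →
        TightNearCap (9 / 5) (3 / 2) z c ∨ ExemptNear (9 / 5) ExRec z c ∨ BadNearCap (9 / 5) (3 / 2) z c) ∨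
      (μ : ℝ) / SC ≤ ∑ b ∈ (Fintype.piFinset fun _ : Fin 3 => Finset.Icc (-7 : ℤ) 7).filter (fun b => b ≠ 0),
        effPot w₄₅ ω₄ (3 / 400) ‖latPt U fccVec b‖ := by
  simp only [entryLeafOK6RBK, Bool.or_eq_true] at h
  rcases h with h | h
  · exact Or.inl (radOK_sound h U hU (hbox_sym hsa hbox))
  · exact entryLeafOKDBsK_sound h U hsa hU hbox h1 h2 h01 h02

/-- ★★ The fcc half from ONE six-coordinate search with the tiered union verdict (any selector). [folklore] -/
theorem fccHalf_of_entrySearch6RBK {m : ℝ} {μ : ℤ} (hμ : 2 * (m + (-(7175 / 10000) + 3 / 400)) * SC ≤ μ)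
    {sel : ℕ → (Fin 3 × Fin 3 → ℤ) → (Fin 3 × Fin 3 → ℤ) → Fin 3 × Fin 3} {fuel d : ℕ}
    (h : searchOK (entryLeafOK6RBK μ) sel fuel d rootC rootW = true) :
    ∀ U : E3 →L[ℝ] E3, (∀ v w : E3, inner ℝ (U v) w = inner ℝ v (U w)) → (∀ w : E3, 0 ≤ inner ℝ w (U w)) → ‖U - 1‖ ≤ 1 / 4 →
      (∀ (M : ℕ) (z : Fin M → E3) (c : Fin M), Function.Injective z →
          Set.range z = {x : E3 | dist x (z c) ≤ 133 / 10 ∧ ∃ a : Fin 3 → ℤ, x = z c + latPt U fccVec a} →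
          TightNearCap (9 / 5) (3 / 2) z c ∨ ExemptNear (9 / 5) ExRec z c ∨ BadNearCap (9 / 5) (3 / 2) z c) ∨
      m ≤ (∑ b ∈ (Fintype.piFinset fun _ : Fin 3 => Finset.Icc (-7 : ℤ) 7).filter (fun b => b ≠ 0),
        effPot w₄₅ ω₄ (3 / 400) ‖latPt U fccVec b‖) / 2 - (-(7175 / 10000) + 3 / 400) := by
  obtain ⟨t, ht⟩ := exists_tree_of_searchOK (entryLeafOK6RBK μ) sel fuel d rootC rootW h
  exact fccHalf_of_entryTreeDom hμ (entryLeafOK6RBK μ)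
    (fun _ _ hv U hsa hU hbox h1 h2 h01 h02 => entryLeafOK6RBK_sound hv U hsa hU hbox h1 h2 h01 h02) ht

/-- ★★★ **`(H) HomFloor m` FROM TWO SEARCH BOOLEANS, tiered tables on the fcc side**: fcc `entryLeafOK6RBK` (fundamental domain ×24, radial, every fit,
v2 table ∨ tiers K1–K4), hcp `entryLeafOKH3RD` (certificate of record v4, unchanged); every `m`, `μ` with `2 (m + e_W) SC ≤ μ`, any selectors. [folklore] -/
theorem homFloor_of_entrySearches6RBK3RD {m : ℝ} {μ : ℤ} (hμ : 2 * (m + (-(7175 / 10000) + 3 / 400)) * SC ≤ μ)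
    {selF : ℕ → (Fin 3 × Fin 3 → ℤ) → (Fin 3 × Fin 3 → ℤ) → Fin 3 × Fin 3} {fuelF dF : ℕ}
    (hF : searchOK (entryLeafOK6RBK μ) selF fuelF dF rootC rootW = true)
    {selH : ℕ → ((Fin 3 × Fin 3) ⊕ Fin 3 → ℤ) → ((Fin 3 × Fin 3) ⊕ Fin 3 → ℤ) → (Fin 3 × Fin 3) ⊕ Fin 3} {fuelH dH : ℕ}
    (hH : searchOK (entryLeafOKH3RD μ) selH fuelH dH rootCH rootWH = true) : HomFloor m :=
  homFloor_of_prunedBoxSums_selfAdjoint (fccHalf_of_entrySearch6RBK hμ hF) (hcpHalf_of_entrySearchH3RD hμ hH)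

/-- ★★★ **`(H) HomFloor (1/625)`** from `entryLeafOK6RBK muRec` × `entryLeafOKH3RD muRec` (any selectors, fuel, depth). [folklore] -/
theorem homFloor_625_of_entrySearches6RBK3RD
    {selF : ℕ → (Fin 3 × Fin 3 → ℤ) → (Fin 3 × Fin 3 → ℤ) → Fin 3 × Fin 3} {fuelF dF : ℕ}
    (hF : searchOK (entryLeafOK6RBK muRec) selF fuelF dF rootC rootW = true)
    {selH : ℕ → ((Fin 3 × Fin 3) ⊕ Fin 3 → ℤ) → ((Fin 3 × Fin 3) ⊕ Fin 3 → ℤ) → (Fin 3 × Fin 3) ⊕ Fin 3} {fuelH dH : ℕ}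
    (hH : searchOK (entryLeafOKH3RD muRec) selH fuelH dH rootCH rootWH = true) : HomFloor (1 / 625) :=
  homFloor_of_entrySearches6RBK3RD muRec_ok hF hH

/-- ★★★ **`(H) HomFloor (1/1000)`** from `entryLeafOK6RBK muMilli` × `entryLeafOKH3RD muMilli`. [folklore] -/
theorem homFloor_milli_of_entrySearches6RBK3RD
    {selF : ℕ → (Fin 3 × Fin 3 → ℤ) → (Fin 3 × Fin 3 → ℤ) → Fin 3 × Fin 3} {fuelF dF : ℕ}
    (hF : searchOK (entryLeafOK6RBK muMilli) selF fuelF dF rootC rootW = true)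
    {selH : ℕ → ((Fin 3 × Fin 3) ⊕ Fin 3 → ℤ) → ((Fin 3 × Fin 3) ⊕ Fin 3 → ℤ) → (Fin 3 × Fin 3) ⊕ Fin 3} {fuelH dH : ℕ}
    (hH : searchOK (entryLeafOKH3RD muMilli) selH fuelH dH rootCH rootWH = true) : HomFloor (1 / 1000) :=
  homFloor_of_entrySearches6RBK3RD muMilli_ok hF hH

/-! ## §5. Kernel smoke test -/

/-- At the identity centre the TIERED table verdict accepts the entry box of half-width `2⁻¹⁰` (`2^38` at scale `SC`), which the v2 table verdict
rejects (its range check fails — hand-1 g21 Pilot D); both evaluated in the kernel. -/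
example : tableLeafOKK muRec rootC (fun _ => 274877906944) = true ∧ tableLeafOK muRec rootC (fun _ => 274877906944) = false := by
  decide +kernel

end Summit.AtomisticToContinuum.Crystallization.Theorems.FrustratedLawDichotomyStrainedPatchHomEntryTableK
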